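import Mathlib
import HarnessLib
import Summits.Ventures.LatticeQCDFlow.Exactness.NCMCGeneralSpaceWorkLaw

/-!
# The Crooks CROSSING diagnostic is sound without densities: forward work mass is below reverse mass on every set left of `ΔF`, above it on every set right of `ΔF`, and the forward work stochastically dominates `−W_rev`

HONEST FRAMING: exact (Metropolis-corrected) sampling algorithms for lattice gauge theory;
figures of merit are autocorrelation/cost numbers at stated couplings and volumes; no
continuum-physics claim.

Venture `LatticeQCDFlow` (cell pub-lqcd), topic `Exactness`; FANOUT row 13 (`eng-snf`, GEN-25).
NEW WORK of the cell (elementary measure theory) on top of GEN-10's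
`NCMCGeneralSpaceWorkLaw.map_work_fwdPathLaw_eq_withDensity` (Crooks' work fluctuation theorem on
a general state space); not a published result; no definition; nothing cited as a fact (Crooks
1999 NAMED ONLY).

WHY (row 13). `latflow-snf`'s `estimators.crooks_crossing(W_f, W_r)` histograms the forward works
`W_f` against MINUS the reverse works `−W_r` on common bins and reports the bin where the difference
`d = hist_f − hist_r` changes sign from `−` to `+` as the estimate of `ΔF` ("Crooks: `P_f(W)/P_r(−W)
= e^{W − dF}` is increasing in `W`, so `d` changes sign from − to + at `W = dF`" — the code
comment). That reasoning is about DENSITIES, which a Crooks pair on a general state space need not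
have. This file types the density-free content, for every Crooks pair with `Z₀, Z₁ ≠ 0`, `e^{−ΔF} =
Z₁/Z₀`, with `F = P_F ∘ W⁻¹` (law of the forward work) and `G = P_R ∘ W⁻¹` (law of the
forward-protocol work of a REVERSE record, i.e. of `−W_r`): (i) `F(A) ≤ G(A)` for every measurable
`A ⊆ (−∞, ΔF]` and `G(A) ≤ F(A)` for every measurable `A ⊆ [ΔF, ∞)` — every histogram bin entirely
left of `ΔF` has `d ≤ 0` in the population, every bin entirely right of it `d ≥ 0`, so a population
sign change of `d` can only happen in the bin containing `ΔF`; (ii) quantitatively, `F(A) ≤ e^{−δ}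
G(A)` left of `ΔF − δ` and `G(A) ≤ e^{−δ} F(A)` right of `ΔF + δ`; (iii) the forward work
STOCHASTICALLY DOMINATES `−W_r`: `P_F(W ≤ w) ≤ P_R(−W_r ≤ w)` for EVERY `w` (a two-sided second law
finer than `⟨W⟩_F ≥ ΔF ≥ ⟨−W_r⟩_R`).

* **`map_work_fwd_le_rev_of_subset_Iic`**, **`map_work_rev_le_fwd_of_subset_Ici`** (§1);
* `map_work_fwd_le_exp_mul_rev`, `map_work_rev_le_exp_mul_fwd` (§1, the `e^{−δ}` separation);
* **`measure_work_le_fwd_le_rev`** (§2) — stochastic dominance of the CDFs, every threshold.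

NOT CLAIMED: anything about the finite-sample histogram estimator (bins, interpolation, noise);
anything numerical.
-/

namespace Summit.Ventures.LatticeQCDFlow.Exactness.GeneralNCMC

open MeasureTheory ProbabilityTheory Set Filter
open scoped ENNReal NNReal

variable {Ω E : Type*} [MeasurableSpace Ω] [MeasurableSpace E]

namespace CrooksPair

variable {ν₀ ν₁ : Measure Ω} [IsFiniteMeasure ν₀] [IsFiniteMeasure ν₁] {κF κR : Kernel Ω E}
  [IsMarkovKernel κF] [IsMarkovKernel κR] {s e : E → Ω} {W : E → ℝ}

/-! ## §1 Bins left of `ΔF` carry less forward mass, bins right of `ΔF` more -/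

omit [IsMarkovKernel κR] in
/-- **LEFT OF `ΔF` THE FORWARD WORK LAW IS BELOW THE REVERSE ONE**: for every measurable
`A ⊆ (−∞, ΔF]`, `P_F(W ∈ A) ≤ P_R(W ∈ A)` (the density `e^{w − ΔF}` is `≤ 1` there). -/
theorem map_work_fwd_le_rev_of_subset_Iic (h0 : ν₀ univ ≠ 0) (h1 : ν₁ univ ≠ 0)
    (h : CrooksPair ν₀ ν₁ κF κR s e W) {ΔF : ℝ}
    (hΔF : Real.exp (-ΔF) = ((ν₀ univ)⁻¹ * ν₁ univ).toReal) {A : Set ℝ} (hA : MeasurableSet A)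
    (hAle : A ⊆ Iic ΔF) :
    ((fwdPathLaw ν₀ κF).map W) A ≤ ((fwdPathLaw ν₁ κR).map W) A := by
  rw [h.map_work_fwdPathLaw_eq_withDensity h0 h1 hΔF, withDensity_apply _ hA]
  calc ∫⁻ w in A, ENNReal.ofReal (Real.exp (w - ΔF)) ∂((fwdPathLaw ν₁ κR).map W)
      ≤ ∫⁻ _w in A, 1 ∂((fwdPathLaw ν₁ κR).map W) := by
        refine setLIntegral_mono measurable_const fun w hw => ?_
        rw [← ENNReal.ofReal_one]
        exact ENNReal.ofReal_le_ofReal (Real.exp_le_one_iff.2 (by linarith [mem_Iic.1 (hAle hw)]))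
    _ = ((fwdPathLaw ν₁ κR).map W) A := by rw [setLIntegral_const, one_mul]

omit [IsMarkovKernel κR] in
/-- **RIGHT OF `ΔF` THE FORWARD WORK LAW IS ABOVE THE REVERSE ONE**: for every measurable
`A ⊆ [ΔF, ∞)`, `P_R(W ∈ A) ≤ P_F(W ∈ A)`. -/
theorem map_work_rev_le_fwd_of_subset_Ici (h0 : ν₀ univ ≠ 0) (h1 : ν₁ univ ≠ 0)
    (h : CrooksPair ν₀ ν₁ κF κR s e W) {ΔF : ℝ}
    (hΔF : Real.exp (-ΔF) = ((ν₀ univ)⁻¹ * ν₁ univ).toReal) {A : Set ℝ} (hA : MeasurableSet A)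
    (hAge : A ⊆ Ici ΔF) :
    ((fwdPathLaw ν₁ κR).map W) A ≤ ((fwdPathLaw ν₀ κF).map W) A := by
  rw [h.map_work_fwdPathLaw_eq_withDensity h0 h1 hΔF, withDensity_apply _ hA]
  calc ((fwdPathLaw ν₁ κR).map W) A = ∫⁻ _w in A, 1 ∂((fwdPathLaw ν₁ κR).map W) := by
        rw [setLIntegral_const, one_mul]
    _ ≤ ∫⁻ w in A, ENNReal.ofReal (Real.exp (w - ΔF)) ∂((fwdPathLaw ν₁ κR).map W) := by
        refine setLIntegral_mono (by fun_prop) fun w hw => ?_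
        rw [← ENNReal.ofReal_one]
        exact ENNReal.ofReal_le_ofReal (Real.one_le_exp_iff.2 (by linarith [mem_Ici.1 (hAge hw)]))

omit [IsMarkovKernel κR] in
/-- **Exponential separation left of the crossing**: for measurable `A ⊆ (−∞, ΔF − δ]`,
`P_F(W ∈ A) ≤ e^{−δ} · P_R(W ∈ A)`. -/
theorem map_work_fwd_le_exp_mul_rev (h0 : ν₀ univ ≠ 0) (h1 : ν₁ univ ≠ 0)
    (h : CrooksPair ν₀ ν₁ κF κR s e W) {ΔF : ℝ}
    (hΔF : Real.exp (-ΔF) = ((ν₀ univ)⁻¹ * ν₁ univ).toReal) (δ : ℝ) {A : Set ℝ}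
    (hA : MeasurableSet A) (hAle : A ⊆ Iic (ΔF - δ)) :
    ((fwdPathLaw ν₀ κF).map W) A
      ≤ ENNReal.ofReal (Real.exp (-δ)) * ((fwdPathLaw ν₁ κR).map W) A := by
  rw [h.map_work_fwdPathLaw_eq_withDensity h0 h1 hΔF, withDensity_apply _ hA]
  calc ∫⁻ w in A, ENNReal.ofReal (Real.exp (w - ΔF)) ∂((fwdPathLaw ν₁ κR).map W)
      ≤ ∫⁻ _w in A, ENNReal.ofReal (Real.exp (-δ)) ∂((fwdPathLaw ν₁ κR).map W) := by
        refine setLIntegral_mono measurable_const fun w hw => ?_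
        exact ENNReal.ofReal_le_ofReal (Real.exp_le_exp.2 (by linarith [mem_Iic.1 (hAle hw)]))
    _ = ENNReal.ofReal (Real.exp (-δ)) * ((fwdPathLaw ν₁ κR).map W) A := by
        rw [setLIntegral_const]

omit [IsMarkovKernel κF] in
/-- **Exponential separation right of the crossing**: for measurable `A ⊆ [ΔF + δ, ∞)`,
`P_R(W ∈ A) ≤ e^{−δ} · P_F(W ∈ A)`. -/
theorem map_work_rev_le_exp_mul_fwd (h0 : ν₀ univ ≠ 0) (h1 : ν₁ univ ≠ 0)
    (h : CrooksPair ν₀ ν₁ κF κR s e W) {ΔF : ℝ}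
    (hΔF : Real.exp (-ΔF) = ((ν₀ univ)⁻¹ * ν₁ univ).toReal) (δ : ℝ) {A : Set ℝ}
    (hA : MeasurableSet A) (hAge : A ⊆ Ici (ΔF + δ)) :
    ((fwdPathLaw ν₁ κR).map W) A
      ≤ ENNReal.ofReal (Real.exp (-δ)) * ((fwdPathLaw ν₀ κF).map W) A := by
  rw [h.map_work_revPathLaw_eq_withDensity h0 h1 hΔF, withDensity_apply _ hA]
  calc ∫⁻ w in A, ENNReal.ofReal (Real.exp (ΔF - w)) ∂((fwdPathLaw ν₀ κF).map W)
      ≤ ∫⁻ _w in A, ENNReal.ofReal (Real.exp (-δ)) ∂((fwdPathLaw ν₀ κF).map W) := by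
        refine setLIntegral_mono measurable_const fun w hw => ?_
        exact ENNReal.ofReal_le_ofReal (Real.exp_le_exp.2 (by linarith [mem_Ici.1 (hAge hw)]))
    _ = ENNReal.ofReal (Real.exp (-δ)) * ((fwdPathLaw ν₀ κF).map W) A := by
        rw [setLIntegral_const]

/-! ## §2 Stochastic dominance: `P_F(W ≤ w) ≤ P_R(−W_r ≤ w)` for every `w` -/

/-- **THE FORWARD WORK STOCHASTICALLY DOMINATES THE (NEGATED) REVERSE WORK**: for every threshold
`w`, `P_F(W ≤ w) ≤ P_R(W ≤ w)` (left of `ΔF` by §1 directly; right of `ΔF` by §1 applied to the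
complementary tail `(w, ∞)` and complementation of probability measures). -/
theorem measure_work_le_fwd_le_rev (h0 : ν₀ univ ≠ 0) (h1 : ν₁ univ ≠ 0)
    (h : CrooksPair ν₀ ν₁ κF κR s e W) {ΔF : ℝ}
    (hΔF : Real.exp (-ΔF) = ((ν₀ univ)⁻¹ * ν₁ univ).toReal) (w : ℝ) :
    ((fwdPathLaw ν₀ κF).map W) (Iic w) ≤ ((fwdPathLaw ν₁ κR).map W) (Iic w) := by
  haveI := isProbabilityMeasure_fwdPathLaw ν₀ h0 κF
  haveI := isProbabilityMeasure_fwdPathLaw ν₁ h1 κR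
  haveI : IsProbabilityMeasure ((fwdPathLaw ν₀ κF).map W) :=
    Measure.isProbabilityMeasure_map h.measurable_W.aemeasurable
  haveI : IsProbabilityMeasure ((fwdPathLaw ν₁ κR).map W) :=
    Measure.isProbabilityMeasure_map h.measurable_W.aemeasurable
  rcases le_or_gt w ΔF with hw | hw
  · exact h.map_work_fwd_le_rev_of_subset_Iic h0 h1 hΔF measurableSet_Iic (Iic_subset_Iic.2 hw)
  · -- tails: `P_R(W > w) ≤ P_F(W > w)`, then complement
    have htail : ((fwdPathLaw ν₁ κR).map W) (Ioi w) ≤ ((fwdPathLaw ν₀ κF).map W) (Ioi w) :=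
      h.map_work_rev_le_fwd_of_subset_Ici h0 h1 hΔF measurableSet_Ioi
        (fun x hx => mem_Ici.2 (le_of_lt (lt_trans hw (mem_Ioi.1 hx))))
    have hF : ((fwdPathLaw ν₀ κF).map W) (Iic w) + ((fwdPathLaw ν₀ κF).map W) (Ioi w) = 1 := by
      rw [← compl_Iic, measure_add_measure_compl measurableSet_Iic, measure_univ]
    have hG : ((fwdPathLaw ν₁ κR).map W) (Iic w) + ((fwdPathLaw ν₁ κR).map W) (Ioi w) = 1 := by
      rw [← compl_Iic, measure_add_measure_compl measurableSet_Iic, measure_univ]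
    have hle : ((fwdPathLaw ν₀ κF).map W) (Iic w) + ((fwdPathLaw ν₀ κF).map W) (Ioi w)
        ≤ ((fwdPathLaw ν₁ κR).map W) (Iic w) + ((fwdPathLaw ν₀ κF).map W) (Ioi w) := by
      rw [hF, ← hG]
      exact add_le_add le_rfl htail
    exact (ENNReal.add_le_add_iff_right (measure_ne_top _ _)).1 hle

/-- **The mirror statement for upper tails**: `P_R(W > w) ≤ P_F(W > w)` for every `w`. -/
theorem measure_work_gt_rev_le_fwd (h0 : ν₀ univ ≠ 0) (h1 : ν₁ univ ≠ 0)
    (h : CrooksPair ν₀ ν₁ κF κR s e W) {ΔF : ℝ}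
    (hΔF : Real.exp (-ΔF) = ((ν₀ univ)⁻¹ * ν₁ univ).toReal) (w : ℝ) :
    ((fwdPathLaw ν₁ κR).map W) (Ioi w) ≤ ((fwdPathLaw ν₀ κF).map W) (Ioi w) := by
  haveI := isProbabilityMeasure_fwdPathLaw ν₀ h0 κF
  haveI := isProbabilityMeasure_fwdPathLaw ν₁ h1 κR
  haveI : IsProbabilityMeasure ((fwdPathLaw ν₀ κF).map W) :=
    Measure.isProbabilityMeasure_map h.measurable_W.aemeasurable
  haveI : IsProbabilityMeasure ((fwdPathLaw ν₁ κR).map W) :=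
    Measure.isProbabilityMeasure_map h.measurable_W.aemeasurable
  have hle := h.measure_work_le_fwd_le_rev h0 h1 hΔF w
  rw [← compl_Iic, prob_compl_eq_one_sub measurableSet_Iic, prob_compl_eq_one_sub measurableSet_Iic]
  exact tsub_le_tsub_left hle 1

end CrooksPair

end Summit.Ventures.LatticeQCDFlow.Exactness.GeneralNCMC
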